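import Literature.Geometry.Riemannian.IndexFluxLimit
import HarnessLib

/-!
# The flux of a field with a radial principal part through shrinking cut-offs: dimension four

Pure analysis on a `4`-dimensional real inner product space `E` (Lebesgue measure): the
four-dimensional companion of `IndexFluxLimit.lean` (which treats the plane), i.e. the analytic
core of the boundary term in Chern's proof of the Gauss–Bonnet–Chern theorem for closed
Riemannian `4`-manifolds — "the flux of the transgression field `Π` out of a small ball around an
isolated nondegenerate zero of the vector field `V` tends to `(2π)²` times the index of the zero"
(Chern 1945, §2, (14)–(16): the index of `V` at an isolated zero is the limit of the integral of
`Π` over small spheres around it; Chern 1944, §2). With the cut-off profile `θ` and the cut-offs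
`χ_r(x) = θ(‖T(x − c)‖²/r²)` of `IndexFluxLimit.lean` (`IndexFlux.profile`, `IndexFlux.cutoff`):

* `integral_deriv_profile_norm_sq_div_four` — `∫_E 2θ'(‖z‖²/r²)/(r²‖z‖²) dz = 2π²` on a
  `4`-dimensional space (polar coordinates: Mathlib's `integral_fun_norm_addHaar`, the volume
  `π²/2` of the unit `4`-ball, and the one-variable integral `integral_Ioi_deriv_profile_comp` of
  the planar file, since `y³ · y⁻² = y`);
* `integral_fderiv_cutoff_radial_four` — **the principal term is exact**: for the radial field of
  degree `−3`, `X₀(x) = κ (x − c)/‖T(x − c)‖⁴`, `∫ dχ_r(X₀) dx = 2π²κ/|det T|` for every `r > 0`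
  (`2π² = vol(S³)`);
* `abs_integral_fderiv_cutoff_sub_le_four` — **the flux estimate**: if on a punctured ball around
  `c` the field `X` is continuous with `‖X(x) − X₀(x)‖ ≤ C_R/‖x − c‖²` (a remainder one degree less
  singular than the principal part) and the density `ρ` is continuous with
  `|ρ(x) − ρ(c)| ≤ C_ρ‖x − c‖`, then `‖∫ dχ_r(X) ρ dx − 2π²κρ(c)/|det T|‖ ≤ C r` for all `r > 0`
  with `2r‖T⁻¹‖ < δ` (on the annulus `r ≤ ‖T(x − c)‖ ≤ 2r`, of volume `O(r⁴)`, `dχ_r = O(1/r)` and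
  the two error terms are `O(r⁻⁴)·O(r)` and `O(r⁻¹)·O(r⁻²)`).

In the application (Chern–Gauss–Bonnet in dimension four), `c` is a nondegenerate zero of a
vector field read in a chart, `L` its linearization, `G₀(v, w) = ⟨Av, Aw⟩` the metric at `c`,
`T = A ∘ L`, and the principal part of Chern's transgression vector density for the constant
metric `G₀` and the linear field `L` is `−2 |det A| det(L) (x − c)/‖T(x − c)‖⁴`, so that the
limit is `−2π² · 2 |det A| det L/(|det A| |det L|) = −(2π)² sign(det L) = −(2π)² (−1)^{index}`.

Everything is proved; no definition and no statement of `Prop` type is introduced (the profile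
and the cut-offs are those of `IndexFluxLimit.lean`).

## References

* S.-S. Chern, *On the curvatura integra in a Riemannian manifold*, Ann. of Math. 46 (1945)
  674–684, §2, (14)–(16) (the index as the limit of the integral of `Π` over small spheres).
  [Chern1945]
* S.-S. Chern, *A simple intrinsic proof of the Gauss–Bonnet formula for closed Riemannian
  manifolds*, Ann. of Math. 45 (1944) 747–752, §2. [Chern1944]
* J. Milnor, *Topology from the differentiable viewpoint* (1965), §6 (the index of a
  nondegenerate zero is the sign of the determinant of the linearization). [Milnor1965]
-/

noncomputable section

open Set Filter MeasureTheory Metric Real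
open scoped Topology RealInnerProductSpace

namespace Literature.Geometry.Riemannian

namespace IndexFlux

variable {E : Type*} [NormedAddCommGroup E] [InnerProductSpace ℝ E]

/-! ### The radial integral `∫ 2 θ'(‖z‖²/r²)/(r² ‖z‖²) dz = 2π²` in dimension four -/

section Radial

variable [FiniteDimensional ℝ E] [MeasurableSpace E] [BorelSpace E]

/-- The real volume of the unit ball of a `4`-dimensional inner product space is `π²/2`.
[folklore] -/
theorem volume_real_ball_zero_one_of_finrank_eq_four (h4 : Module.finrank ℝ E = 4) :
    (volume : Measure E).real (ball 0 1) = π ^ 2 / 2 := by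
  haveI : Nontrivial E := Module.nontrivial_of_finrank_pos (R := ℝ) (by omega)
  rw [Measure.real, InnerProductSpace.volume_ball_of_dim_even (k := 2) (by rw [h4]) (0 : E) 1]
  simp only [ENNReal.ofReal_one, one_pow, one_mul, Nat.factorial_two, Nat.cast_ofNat]
  rw [ENNReal.toReal_ofReal (by positivity)]

/-- The real volume of a ball of radius `s` in a `4`-dimensional inner product space is
`π² s⁴/2`. [folklore] -/
theorem volume_real_closedBall_of_finrank_eq_four (h4 : Module.finrank ℝ E = 4) (c : E) {s : ℝ}
    (hs : 0 ≤ s) : (volume : Measure E).real (closedBall c s) = π ^ 2 / 2 * s ^ 4 := by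
  haveI : Nontrivial E := Module.nontrivial_of_finrank_pos (R := ℝ) (by omega)
  rw [Measure.real, InnerProductSpace.volume_closedBall_of_dim_even (k := 2) (by rw [h4]) c s, h4,
    ENNReal.toReal_mul, ← ENNReal.ofReal_pow hs, ENNReal.toReal_ofReal (by positivity),
    ENNReal.toReal_ofReal (by positivity)]
  simp only [Nat.factorial_two, Nat.cast_ofNat]
  ring

/-- **The radial integral in dimension four**: on a `4`-dimensional inner product space,
`∫ 2 θ'(‖z‖²/r²)/(r² ‖z‖²) dz = 2π²` (polar coordinates, `integral_fun_norm_addHaar`, the volume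
`π²/2` of the unit ball, and `integral_Ioi_deriv_profile_comp`: the radial weight `y³` against
`y⁻²` leaves `∫₀^∞ θ'(y²/r²) (2y/r²) dy = 1`). [folklore] -/
theorem integral_deriv_profile_norm_sq_div_four (h4 : Module.finrank ℝ E = 4) {r : ℝ}
    (hr : 0 < r) :
    ∫ z : E, deriv profile (‖z‖ ^ 2 / r ^ 2) * (2 / r ^ 2) / ‖z‖ ^ 2 = 2 * π ^ 2 := by
  haveI : Nontrivial E := Module.nontrivial_of_finrank_pos (R := ℝ) (by omega)
  have h := MeasureTheory.integral_fun_norm_addHaar (volume : Measure E)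
    (fun y ↦ deriv profile (y ^ 2 / r ^ 2) * (2 / r ^ 2) / y ^ 2)
  rw [h, h4, volume_real_ball_zero_one_of_finrank_eq_four h4]
  have hI : ∫ y in Ioi (0:ℝ), y ^ (4 - 1) • (deriv profile (y ^ 2 / r ^ 2) * (2 / r ^ 2) / y ^ 2)
      = 1 := by
    rw [← integral_Ioi_deriv_profile_comp hr]
    refine setIntegral_congr_fun measurableSet_Ioi fun y hy ↦ ?_
    have hy0 : (y : ℝ) ≠ 0 := (mem_Ioi.1 hy).ne'
    simp only [show 4 - 1 = 3 from rfl, smul_eq_mul]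
    field_simp
  rw [hI]
  simp only [nsmul_eq_mul, smul_eq_mul, Nat.cast_ofNat]
  ring

end Radial

/-! ### The cut-offs against the radial field of degree `−3` -/

/-- The derivative of the cut-off on the radial field of degree `−3`: for `u = x − c` with
`Tu ≠ 0`, `dχ_r(x) (κ u/‖Tu‖⁴) = κ θ'(‖Tu‖²/r²) (2/r²)/‖Tu‖²`. [folklore] -/
theorem fderiv_cutoff_radial_four (T : E →L[ℝ] E) (c : E) (r κ : ℝ) {x : E}
    (hx : T (x - c) ≠ 0) :
    fderiv ℝ (cutoff T c r) x ((κ / ‖T (x - c)‖ ^ 4) • (x - c)) =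
      κ * (deriv profile (‖T (x - c)‖ ^ 2 / r ^ 2) * (2 / r ^ 2)) / ‖T (x - c)‖ ^ 2 := by
  rw [fderiv_cutoff_apply, map_smul, real_inner_smul_right, real_inner_self_eq_norm_sq]
  have : ‖T (x - c)‖ ≠ 0 := norm_ne_zero_iff.2 hx
  field_simp

section Flux

variable [FiniteDimensional ℝ E] [MeasurableSpace E] [BorelSpace E]

omit [FiniteDimensional ℝ E] [MeasurableSpace E] [BorelSpace E] in
/-- `dχ_r(x)` applied to the radial field `κ (x−c)/‖T(x−c)‖⁴` is `κ θ'(‖T(x−c)‖²/r²)(2/r²)/‖T(x−c)‖²`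
at every point (both sides vanish at `x = c`). [folklore] -/
theorem fderiv_cutoff_radial_four' (T : E ≃L[ℝ] E) (c : E) (r : ℝ) (κ : ℝ) (x : E) :
    fderiv ℝ (cutoff (T : E →L[ℝ] E) c r) x ((κ / ‖T (x - c)‖ ^ 4) • (x - c)) =
      κ * (deriv profile (‖T (x - c)‖ ^ 2 / r ^ 2) * (2 / r ^ 2)) / ‖T (x - c)‖ ^ 2 := by
  by_cases hx : x = c
  · subst hx
    simp
  · have hT : (T : E →L[ℝ] E) (x - c) ≠ 0 := fun h ↦
      hx (sub_eq_zero.1 (T.injective (by rw [map_zero]; exact h)))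
    exact fderiv_cutoff_radial_four (T : E →L[ℝ] E) c r κ hT

/-- **The principal term is exact (dimension four)**:
`∫ dχ_r(x)(κ (x−c)/‖T(x−c)‖⁴) dx = 2π² κ/|det T|` on a `4`-dimensional inner product space, for
every `r > 0` (translation, the linear change of variables `z = T(x − c)`, and the radial
integral `integral_deriv_profile_norm_sq_div_four`). This is Chern's "the integral of `Π` over a
small sphere around a nondegenerate zero", `2π² = vol(S³)`, in cut-off form.
[cite: Chern1945, §2, (14)–(16)] -/
theorem integral_fderiv_cutoff_radial_four (h4 : Module.finrank ℝ E = 4) (T : E ≃L[ℝ] E) (c : E)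
    {r : ℝ} (hr : 0 < r) (κ : ℝ) :
    ∫ x, fderiv ℝ (cutoff (T : E →L[ℝ] E) c r) x ((κ / ‖T (x - c)‖ ^ 4) • (x - c)) =
      2 * π ^ 2 * κ / |LinearMap.det (T : E →ₗ[ℝ] E)| := by
  simp_rw [fderiv_cutoff_radial_four' T c r κ]
  have h := integral_sub_right_eq_self (μ := (volume : Measure E))
    (fun u : E ↦ κ * (deriv profile (‖T u‖ ^ 2 / r ^ 2) * (2 / r ^ 2)) / ‖T u‖ ^ 2) c
  have h3 := integral_comp_continuousLinearEquiv T
    (fun z : E ↦ κ * (deriv profile (‖z‖ ^ 2 / r ^ 2) * (2 / r ^ 2)) / ‖z‖ ^ 2)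
  rw [h, h3]
  have h5 : ∫ z : E, κ * (deriv profile (‖z‖ ^ 2 / r ^ 2) * (2 / r ^ 2)) / ‖z‖ ^ 2 =
      κ * ∫ z : E, deriv profile (‖z‖ ^ 2 / r ^ 2) * (2 / r ^ 2) / ‖z‖ ^ 2 := by
    rw [← integral_const_mul]
    refine integral_congr_ae (Eventually.of_forall fun z ↦ ?_)
    ring
  rw [h5, integral_deriv_profile_norm_sq_div_four h4 hr]
  ring

omit [FiniteDimensional ℝ E] [MeasurableSpace E] [BorelSpace E] in
/-- The principal integrand `x ↦ dχ_r(x)(κ (x−c)/‖T(x−c)‖⁴)` is continuous (it is locally zero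
off the annulus `r ≤ ‖T(x−c)‖ ≤ 2r` and an explicit quotient with nonvanishing denominator near
it). [folklore] -/
theorem continuous_fderiv_cutoff_radial_four (T : E ≃L[ℝ] E) (c : E) {r : ℝ} (hr : 0 < r)
    (κ : ℝ) :
    Continuous fun x ↦
      fderiv ℝ (cutoff (T : E →L[ℝ] E) c r) x ((κ / ‖T (x - c)‖ ^ 4) • (x - c)) := by
  have hqc : Continuous fun y : E ↦ ‖T (y - c)‖ ^ 2 / r ^ 2 :=
    (((T : E →L[ℝ] E).continuous.comp (continuous_id.sub continuous_const)).norm.pow 2).div_const _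
  have hTc : Continuous fun y : E ↦ ‖T (y - c)‖ :=
    ((T : E →L[ℝ] E).continuous.comp (continuous_id.sub continuous_const)).norm
  rw [continuous_iff_continuousAt]
  intro x
  by_cases hq : ‖T (x - c)‖ ^ 2 / r ^ 2 < 1 ∨ 4 < ‖T (x - c)‖ ^ 2 / r ^ 2
  · have hev : ∀ᶠ y in 𝓝 x, ‖T (y - c)‖ ^ 2 / r ^ 2 < 1 ∨ 4 < ‖T (y - c)‖ ^ 2 / r ^ 2 := by
      rcases hq with hq | hq
      · exact (hqc.continuousAt.eventually (Iio_mem_nhds hq)).mono fun y hy ↦ Or.inl hy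
      · exact (hqc.continuousAt.eventually (Ioi_mem_nhds hq)).mono fun y hy ↦ Or.inr hy
    refine continuousAt_const.congr (f := fun _ ↦ (0 : ℝ)) ?_
    filter_upwards [hev] with y hy
    rw [fderiv_cutoff_eq_zero hy, _root_.zero_apply]
  · rw [not_or, not_lt, not_lt] at hq
    have hr1 : r ≤ ‖T (x - c)‖ := by
      have := hq.1
      rw [le_div_iff₀ (by positivity)] at this
      nlinarith [norm_nonneg (T (x - c))]
    have hTx : ‖T (x - c)‖ ≠ 0 := by
      intro h0
      rw [h0] at hr1
      linarith
    have hcont : ContinuousAt (fun y ↦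
        κ * (deriv profile (‖T (y - c)‖ ^ 2 / r ^ 2) * (2 / r ^ 2)) / ‖T (y - c)‖ ^ 2) x :=
      ((continuous_const.mul ((continuous_deriv_profile.comp hqc).mul
        continuous_const)).continuousAt).div (hTc.pow 2).continuousAt (pow_ne_zero 2 hTx)
    exact hcont.congr (Eventually.of_forall fun y ↦ (fderiv_cutoff_radial_four' T c r κ y).symm)

/-- **Flux of a field with a radial principal part of degree `−3` through shrinking cut-offs
(dimension four).** In a `4`-dimensional inner product space `E` let `T` be a linear
automorphism, `c` a point, `κ ∈ ℝ`, and on a punctured ball around `c` let `X` be a continuous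
field with `‖X(x) − κ (x−c)/‖T(x−c)‖⁴‖ ≤ C_R/‖x − c‖²` (remainder one degree less singular than the
principal part) and `ρ` a continuous density with `|ρ(x) − ρ(c)| ≤ C_ρ ‖x − c‖`. Then for the
cut-offs `χ_r(x) = θ(‖T(x−c)‖²/r²)`, `‖∫ dχ_r(X) ρ dx − 2π² κ ρ(c)/|det T|‖ ≤ C r` for all
`r > 0` with `2r‖T⁻¹‖ < δ`: the principal part contributes exactly `2π² κ ρ(c)/|det T|`
(`integral_fderiv_cutoff_radial_four`), and on the annulus `r ≤ ‖T(x−c)‖ ≤ 2r` (volume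
`O(r⁴)`, where `dχ_r = O(1/r)`) the two error terms are `O(r⁻⁴)·O(r)` and `O(r⁻¹)·O(r⁻²)`,
i.e. `O(r⁻³)`. This is the analytic core of "the boundary term at an isolated nondegenerate zero
is `(2π)²` times the index" in Chern's proof of the Gauss–Bonnet–Chern theorem in dimension
four. [cite: Chern1945, §2, (14)–(16)] -/
theorem abs_integral_fderiv_cutoff_sub_le_four (h4 : Module.finrank ℝ E = 4) (T : E ≃L[ℝ] E)
    (c : E) (κ : ℝ) {X : E → E} {ρ : E → ℝ} {δ CR Cρ : ℝ}
    (hXc : ContinuousOn X (ball c δ \ {c})) (hρc : ContinuousOn ρ (ball c δ))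
    (hR : ∀ x ∈ ball c δ \ {c}, ‖X x - (κ / ‖T (x - c)‖ ^ 4) • (x - c)‖ ≤ CR / ‖x - c‖ ^ 2)
    (hρL : ∀ x ∈ ball c δ, |ρ x - ρ c| ≤ Cρ * ‖x - c‖) :
    ∃ C : ℝ, ∀ r : ℝ, 0 < r → 2 * r * ‖(T.symm : E →L[ℝ] E)‖ < δ →
      ‖(∫ x, fderiv ℝ (cutoff (T : E →L[ℝ] E) c r) x (X x) * ρ x) -
        2 * π ^ 2 * κ * ρ c / |LinearMap.det (T : E →ₗ[ℝ] E)|‖ ≤ C * r := by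
  obtain ⟨B, hB0, hB⟩ := exists_bound_deriv_profile
  set N : ℝ := ‖(T.symm : E →L[ℝ] E)‖ with hN
  set NT : ℝ := ‖(T : E →L[ℝ] E)‖ with hNT
  set CR' : ℝ := max CR 0 with hCR'
  set Cρ' : ℝ := max Cρ 0 with hCρ'
  set M : ℝ := 4 * |κ| * B * Cρ' * N + 4 * B * NT ^ 3 * CR' * (|ρ c| + Cρ' * |δ|) with hM
  have hM0 : 0 ≤ M := by positivity
  refine ⟨M * (8 * π ^ 2 * N ^ 4), fun r hr hrδ ↦ ?_⟩
  -- notation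
  set D := fderiv ℝ (cutoff (T : E →L[ℝ] E) c r) with hD
  set X₀ : E → E := fun x ↦ (κ / ‖T (x - c)‖ ^ 4) • (x - c) with hX₀
  set K : Set E := closedBall c (2 * r * N) with hK
  -- where `dχ_r ≠ 0`
  have hsupp : ∀ x, D x ≠ 0 → x ∈ K ∧ x ∈ ball c δ ∧ x ≠ c ∧ r ≤ ‖T (x - c)‖ ∧
      ‖T (x - c)‖ ≤ 2 * r := by
    intro x hx
    obtain ⟨h1, h2'⟩ := norm_le_of_fderiv_cutoff_ne_zero hr hx
    have hxc : ‖x - c‖ ≤ 2 * r * N := by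
      calc ‖x - c‖ = ‖(T.symm : E →L[ℝ] E) (T (x - c))‖ := by simp
        _ ≤ N * ‖T (x - c)‖ := (T.symm : E →L[ℝ] E).le_opNorm _
        _ ≤ N * (2 * r) := by gcongr; exact h2'
        _ = 2 * r * N := by ring
    refine ⟨mem_closedBall_iff_norm.2 hxc, mem_ball_iff_norm.2 (hxc.trans_lt hrδ), ?_, h1, h2'⟩
    rintro rfl
    simp only [sub_self, map_zero, norm_zero] at h1
    linarith
  have hzero : ∀ x, x ∉ K → D x = 0 := fun x hx ↦ by
    by_contra h
    exact hx (hsupp x h).1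
  -- the principal part: `D x (X₀ x) = κ θ'(q x) (2/r²)/‖T(x-c)‖²`, continuous, integral
  -- `2π²κ/|det T|`
  have hP : ∀ x, D x (X₀ x) =
      κ * (deriv profile (‖T (x - c)‖ ^ 2 / r ^ 2) * (2 / r ^ 2)) / ‖T (x - c)‖ ^ 2 :=
    fun x ↦ fderiv_cutoff_radial_four' T c r κ x
  have hqc : Continuous fun y : E ↦ ‖T (y - c)‖ ^ 2 / r ^ 2 :=
    (((T : E →L[ℝ] E).continuous.comp (continuous_id.sub continuous_const)).norm.pow 2).div_const _
  have hPc0 : Continuous fun x ↦ D x (X₀ x) := continuous_fderiv_cutoff_radial_four T c hr κ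
  have hPc : Continuous fun x ↦ D x (X₀ x) * ρ c := hPc0.mul continuous_const
  have hPint : ∫ x, D x (X₀ x) * ρ c = 2 * π ^ 2 * κ * ρ c / |LinearMap.det (T : E →ₗ[ℝ] E)| := by
    rw [integral_mul_const, integral_fderiv_cutoff_radial_four h4 T c hr κ]
    ring
  -- continuity of the full integrand: it is `0` near the complement of the annulus and a
  -- product of continuous functions on the punctured ball
  have hfc : Continuous fun x ↦ D x (X x) * ρ x := by
    rw [continuous_iff_continuousAt]
    intro x
    by_cases hq : ‖T (x - c)‖ ^ 2 / r ^ 2 < 1 ∨ 4 < ‖T (x - c)‖ ^ 2 / r ^ 2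
    · -- locally zero
      have hev : ∀ᶠ y in 𝓝 x, ‖T (y - c)‖ ^ 2 / r ^ 2 < 1 ∨ 4 < ‖T (y - c)‖ ^ 2 / r ^ 2 := by
        rcases hq with hq | hq
        · exact (hqc.continuousAt.eventually (Iio_mem_nhds hq)).mono fun y hy ↦ Or.inl hy
        · exact (hqc.continuousAt.eventually (Ioi_mem_nhds hq)).mono fun y hy ↦ Or.inr hy
      refine continuousAt_const.congr (f := fun _ ↦ (0 : ℝ)) ?_
      filter_upwards [hev] with y hy
      rw [hD, fderiv_cutoff_eq_zero hy, _root_.zero_apply, zero_mul]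
    · -- in the punctured ball
      rw [not_or, not_lt, not_lt] at hq
      have hr1 : r ≤ ‖T (x - c)‖ := by
        have := hq.1
        rw [le_div_iff₀ (by positivity)] at this
        nlinarith [norm_nonneg (T (x - c))]
      have hr2 : ‖T (x - c)‖ ≤ 2 * r := by
        have := hq.2
        rw [div_le_iff₀ (by positivity)] at this
        nlinarith [norm_nonneg (T (x - c))]
      have hxc : ‖x - c‖ ≤ 2 * r * N := by
        calc ‖x - c‖ = ‖(T.symm : E →L[ℝ] E) (T (x - c))‖ := by simp
          _ ≤ N * ‖T (x - c)‖ := (T.symm : E →L[ℝ] E).le_opNorm _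
          _ ≤ N * (2 * r) := by gcongr
          _ = 2 * r * N := by ring
      have hxball : x ∈ ball c δ := mem_ball_iff_norm.2 (hxc.trans_lt hrδ)
      have hxne : x ≠ c := by
        rintro rfl
        simp only [sub_self, map_zero, norm_zero] at hr1
        linarith
      have hU : ball c δ \ {c} ∈ 𝓝 x :=
        (isOpen_ball.sdiff isClosed_singleton).mem_nhds ⟨hxball, hxne⟩
      have h1 : ContinuousOn (fun y ↦ D y (X y)) (ball c δ \ {c}) :=
        (continuous_fderiv_cutoff (T : E →L[ℝ] E) c r).continuousOn.clm_apply hXc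
      exact ((h1.mul (hρc.mono sdiff_subset)).continuousAt hU)
  have hfsupp : HasCompactSupport fun x ↦ D x (X x) * ρ x := by
    refine HasCompactSupport.intro (isCompact_closedBall c (2 * r * N)) fun x hx ↦ ?_
    simp only [hzero x hx, _root_.zero_apply, zero_mul]
  have hPsupp : HasCompactSupport fun x ↦ D x (X₀ x) * ρ c := by
    refine HasCompactSupport.intro (isCompact_closedBall c (2 * r * N)) fun x hx ↦ ?_
    simp only [hzero x hx, _root_.zero_apply, zero_mul]
  have hfi : Integrable (fun x ↦ D x (X x) * ρ x) := hfc.integrable_of_hasCompactSupport hfsupp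
  have hPi : Integrable (fun x ↦ D x (X₀ x) * ρ c) := hPc.integrable_of_hasCompactSupport hPsupp
  -- the error term
  set g : E → ℝ := fun x ↦ D x (X x) * ρ x - D x (X₀ x) * ρ c with hg
  have hgi : Integrable g := hfi.sub hPi
  have hg0 : ∀ x, x ∉ K → g x = 0 := fun x hx ↦ by
    simp only [hg, hzero x hx, _root_.zero_apply, zero_mul, sub_self]
  have hgb : ∀ x ∈ K, ‖g x‖ ≤ M / r ^ 3 := by
    intro x _
    by_cases hDx : D x = 0
    · simp only [hg, hDx, _root_.zero_apply, zero_mul, sub_self, norm_zero]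
      positivity
    obtain ⟨-, hxball, hxne, hr1, hr2⟩ := hsupp x hDx
    have hxc : ‖x - c‖ ≤ 2 * r * N := by
      calc ‖x - c‖ = ‖(T.symm : E →L[ℝ] E) (T (x - c))‖ := by simp
        _ ≤ N * ‖T (x - c)‖ := (T.symm : E →L[ℝ] E).le_opNorm _
        _ ≤ N * (2 * r) := by gcongr
        _ = 2 * r * N := by ring
    have hxδ : ‖x - c‖ ≤ |δ| := (mem_ball_iff_norm.1 hxball).le.trans (le_abs_self δ)
    have hu0 : 0 < ‖x - c‖ := norm_pos_iff.2 (sub_ne_zero.2 hxne)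
    -- `r ≤ ‖T u‖ ≤ ‖T‖ ‖u‖`
    have hrNT : r ≤ NT * ‖x - c‖ := hr1.trans ((T : E →L[ℝ] E).le_opNorm _)
    have hNT0 : 0 < NT := by
      by_contra h
      rw [not_lt] at h
      have : NT * ‖x - c‖ ≤ 0 := mul_nonpos_of_nonpos_of_nonneg h (norm_nonneg _)
      linarith
    -- the pieces
    have hRx : ‖X x - X₀ x‖ ≤ CR' * NT ^ 2 / r ^ 2 := by
      have h1 : ‖X x - X₀ x‖ ≤ CR' / ‖x - c‖ ^ 2 :=
        (hR x ⟨hxball, hxne⟩).trans (div_le_div_of_nonneg_right (le_max_left _ _) (by positivity))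
      refine h1.trans ?_
      rw [div_le_div_iff₀ (by positivity) (by positivity)]
      have h2 : r ^ 2 ≤ (NT * ‖x - c‖) ^ 2 := by gcongr
      calc CR' * r ^ 2 ≤ CR' * (NT * ‖x - c‖) ^ 2 := by gcongr
        _ = CR' * NT ^ 2 * ‖x - c‖ ^ 2 := by ring
    have hρx : |ρ x - ρ c| ≤ Cρ' * ‖x - c‖ :=
      (hρL x hxball).trans (mul_le_mul_of_nonneg_right (le_max_left _ _) (norm_nonneg _))
    have hρx' : |ρ x| ≤ |ρ c| + Cρ' * |δ| := by
      calc |ρ x| = |ρ c + (ρ x - ρ c)| := by ring_nf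
        _ ≤ |ρ c| + |ρ x - ρ c| := abs_add_le _ _
        _ ≤ |ρ c| + Cρ' * ‖x - c‖ := by linarith
        _ ≤ |ρ c| + Cρ' * |δ| := by gcongr
    have hDX₀ : |D x (X₀ x)| ≤ 2 * |κ| * B / r ^ 4 := by
      rw [hP x, abs_div, abs_mul, abs_mul, abs_of_pos (by positivity : (0:ℝ) < 2 / r ^ 2),
        abs_of_nonneg (by positivity : (0:ℝ) ≤ ‖T (x - c)‖ ^ 2)]
      have hT2 : r ^ 2 ≤ ‖T (x - c)‖ ^ 2 := by gcongr
      have hT2pos : 0 < ‖T (x - c)‖ ^ 2 := lt_of_lt_of_le (by positivity) hT2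
      rw [div_le_div_iff₀ hT2pos (by positivity)]
      calc |κ| * (|deriv profile (‖T (x - c)‖ ^ 2 / r ^ 2)| * (2 / r ^ 2)) * r ^ 4
          ≤ |κ| * (B * (2 / r ^ 2)) * r ^ 4 := by gcongr; exact hB _
        _ = 2 * |κ| * B * r ^ 2 := by field_simp
        _ ≤ 2 * |κ| * B * ‖T (x - c)‖ ^ 2 := mul_le_mul_of_nonneg_left hT2 (by positivity)
    have hDR : |D x (X x - X₀ x)| ≤ 4 * B * NT ^ 3 * CR' / r ^ 3 := by
      have h1 : |D x (X x - X₀ x)| ≤ 4 * B * NT * ‖X x - X₀ x‖ / r :=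
        abs_fderiv_cutoff_le hr hB0 hB x _
      have h2 : 4 * B * NT * ‖X x - X₀ x‖ / r ≤ 4 * B * NT * (CR' * NT ^ 2 / r ^ 2) / r := by
        gcongr
      have h3 : 4 * B * NT * (CR' * NT ^ 2 / r ^ 2) / r = 4 * B * NT ^ 3 * CR' / r ^ 3 := by
        rw [eq_div_iff (by positivity)]
        field_simp
      linarith
    -- assemble
    have hgx : g x = D x (X₀ x) * (ρ x - ρ c) + D x (X x - X₀ x) * ρ x := by
      simp only [hg, map_sub]
      ring
    rw [Real.norm_eq_abs, hgx]
    calc |D x (X₀ x) * (ρ x - ρ c) + D x (X x - X₀ x) * ρ x|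
        ≤ |D x (X₀ x)| * |ρ x - ρ c| + |D x (X x - X₀ x)| * |ρ x| := by
          rw [← abs_mul, ← abs_mul]; exact abs_add_le _ _
      _ ≤ (2 * |κ| * B / r ^ 4) * (Cρ' * (2 * r * N)) +
          (4 * B * NT ^ 3 * CR' / r ^ 3) * (|ρ c| + Cρ' * |δ|) := by
          gcongr
          · exact hρx.trans (by gcongr)
      _ = M / r ^ 3 := by
          rw [hM]
          field_simp
          ring
  -- the estimate
  have hgK : ∫ x, g x = ∫ x in K, g x :=
    (setIntegral_eq_integral_of_forall_compl_eq_zero fun x hx ↦ hg0 x hx).symm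
  have hKvol : (volume : Measure E).real K = π ^ 2 / 2 * (2 * r * N) ^ 4 :=
    volume_real_closedBall_of_finrank_eq_four h4 c (by positivity)
  have hKfin : volume K < ⊤ := measure_closedBall_lt_top
  have hbound : ‖∫ x in K, g x‖ ≤ M / r ^ 3 * (volume : Measure E).real K :=
    norm_setIntegral_le_of_norm_le_const hKfin hgb
  have hsplit : (∫ x, D x (X x) * ρ x) - 2 * π ^ 2 * κ * ρ c / |LinearMap.det (T : E →ₗ[ℝ] E)| =
      ∫ x, g x := by
    rw [← hPint, ← integral_sub hfi hPi]
  rw [hsplit, hgK]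
  calc ‖∫ x in K, g x‖ ≤ M / r ^ 3 * (volume : Measure E).real K := hbound
    _ = M * (8 * π ^ 2 * N ^ 4) * r := by
        rw [hKvol]
        field_simp
        ring

end Flux

end IndexFlux

end Literature.Geometry.Riemannian

end
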